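import Summits.AtomisticToContinuum.FouriersLaw.Theorems.VanishingNoiseTransferNoiseLocalityStubDuhamelFlipBoundAux1
import Summits.AtomisticToContinuum.FouriersLaw.Theorems.VanishingNoiseTransferNoiseLocalityStubDuhamelFlipBoundAux2
import Summits.AtomisticToContinuum.FouriersLaw.Theorems.VanishingNoiseTransferNoiseLocalityStubDuhamelFlipBoundAux3
import Summits.AtomisticToContinuum.FouriersLaw.Theorems.OddSectorIrreversibilityBoundedResponse

/-!
# Stub `stub_duhamelFlipBound` of crux `NoiseLocality` (line `relative-flip-energy-transfer`):
the Duhamel identity in the flip Dirichlet form and its Cauchy–Schwarz bound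

File `--supports stmt-AtomisticToContinuum-11975` (crux `NoiseLocality`, route `VanishingNoiseTransfer`),
registered stub 2 of the skeleton `relative_flip_energy_transfer`.

**Theorem (`stub_duhamelFlipBound`).** Pinned anharmonic chain `pinnedChain ω₂ lam β γ` (all parameters
`> 0`) between Langevin baths, `T > 0`, any length `N`, any flip rate `ε > 0`. Let `μ0` be the unique
deterministic weak steady family, `με` the unique weak steady family of `L + εS` (`S` the velocity-flip
generator), `U0, Uε` response densities of the two families at `T` (`L²(μ_T)`, `HasDerivAt` clauses on
test functions and on the total current) and `D0, Dε` the response coefficients. Then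
`|Dε − D0| ≤ ε (N−1) T² √𝓔_f(Uε) √𝓔_f(U0)`, `𝓔_f(U) = ½ ∑_i ∫ (U − U∘Θ_i)² dμ_T`.

Proof (`N ≥ 2`; for `N ≤ 1` the total current vanishes identically and `D0 = Dε = 0`). With `μ_T` the
Gibbs measure (`μ0 T T = με T T = μ_T` by uniqueness), `J = ∑_i j_i`, `φ = γ(p_0² − p_{N−1}²)/(2T²)`:
(1) `D0 = ∫ J U0 dμ_T`, `Dε = ∫ J Uε dμ_T` (`responseCoeff_eq`); (2) the weak adjoint equations
`∫ (LF) U0 = −∫ F φ`, `∫ (LF + εSF) Uε = −∫ F φ` for `F ∈ C_c^∞` (part 1), whence for `W = Uε − U0`: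
`∫ (LF) W = ∫ F · (−ε S Uε)` (`S` symmetric); (3) the closure theorem of part 2 applied to the weak pair
`(Ψ, LΨ)` (`Ψ` the flip-invariant McLennan potential, `LΨ = J/((N−1)T²) + φ`, part 3) gives
`∫ (LΨ) W = −ε ∫ (SΨ) Uε = 0`, i.e. `∫ J W = −(N−1)T² ∫ φ W`; applied to the weak pair `(U0∘Θ, −φ)`
(which is (2) read through `L† = ΘLΘ`) it gives `∫ φ W = ε ∫ (U0∘Θ)(S Uε)`; (4) hence
`Dε − D0 = −ε(N−1)T² ∫ (U0∘Θ)(S Uε) dμ_T`, and Cauchy–Schwarz in the flip form plus the `Θ`-invariance of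
the flip energy (part 3) give the bound. No definitions.
-/

noncomputable section

open MeasureTheory Filter Topology
open scoped ContDiff

namespace Summit.AtomisticToContinuum.FouriersLaw.Theorems.NoiseLocality

open Literature.MathematicalPhysics.KineticTheory.HeatConduction
open Summit.AtomisticToContinuum.FouriersLaw.Theorems.OddSectorIrreversibility
open Summit.AtomisticToContinuum.FouriersLaw.Theorems.NoiseLocality.StubResponseDensityNoisy
open Summit.AtomisticToContinuum.FouriersLaw.Theorems.NoiseLocality.StubDuhamelFlipBound
open Literature.Barriers.AtomisticToContinuum.OpenChain

namespace StubDuhamelFlipBound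

variable {ω₂ lam β γ : ℝ} {N : ℕ} {T : ℝ}

/-- **The Duhamel identity and bound, main case `N ≥ 2`**, with the response densities and their
pairings with the total current already in hand: if `U0, Uε ∈ L²(μ_T)` satisfy the weak adjoint
equations `∫ (L F) U0 dμ_T = −∫ F φ dμ_T` and `∫ (L F + ε S F) Uε dμ_T = −∫ F φ dμ_T` for all test `F`
(`φ` the McLennan source), then
`|∫ J Uε dμ_T − ∫ J U0 dμ_T| ≤ ε (N−1) T² √𝓔_f(Uε) √𝓔_f(U0)`. See the module docstring. -/
theorem abs_sub_le_of_weak (hω : 0 < ω₂) (hl : 0 ≤ lam) (hβ : 0 < β) (hγ : 0 < γ) (hN : 2 ≤ N)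
    (hT : 0 < T) {ε : ℝ} (hε : 0 < ε) {U0 Uε : PhaseSpace N → ℝ}
    (hU0m : MemLp U0 2 ((pinnedChain ω₂ lam β γ).gibbsMeasure N T))
    (hUεm : MemLp Uε 2 ((pinnedChain ω₂ lam β γ).gibbsMeasure N T))
    (hE0 : ∀ F : PhaseSpace N → ℝ, ContDiff ℝ ∞ F → HasCompactSupport F →
      ∫ x, (pinnedChain ω₂ lam β γ).generator N T T F x * U0 x ∂((pinnedChain ω₂ lam β γ).gibbsMeasure N T) =
        -∫ x, F x * (γ / (2 * T ^ 2) * (x.2 ⟨0, by omega⟩ ^ 2 - x.2 ⟨N - 1, by omega⟩ ^ 2))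
          ∂((pinnedChain ω₂ lam β γ).gibbsMeasure N T))
    (hEε : ∀ F : PhaseSpace N → ℝ, ContDiff ℝ ∞ F → HasCompactSupport F →
      ∫ x, (pinnedChain ω₂ lam β γ).flipGenerator N T T ε F x * Uε x
          ∂((pinnedChain ω₂ lam β γ).gibbsMeasure N T) =
        -∫ x, F x * (γ / (2 * T ^ 2) * (x.2 ⟨0, by omega⟩ ^ 2 - x.2 ⟨N - 1, by omega⟩ ^ 2))
          ∂((pinnedChain ω₂ lam β γ).gibbsMeasure N T)) :
    |(∫ x, (∑ i : Fin N, (pinnedChain ω₂ lam β γ).bondCurrent N i x) * Uε x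
        ∂((pinnedChain ω₂ lam β γ).gibbsMeasure N T)) -
      ∫ x, (∑ i : Fin N, (pinnedChain ω₂ lam β γ).bondCurrent N i x) * U0 x
        ∂((pinnedChain ω₂ lam β γ).gibbsMeasure N T)| ≤
      ε * ((N : ℝ) - 1) * T ^ 2 *
        Real.sqrt ((1 / 2) * ∑ i : Fin N, ∫ x, (Uε x - Uε (momentumFlip i x)) ^ 2
          ∂((pinnedChain ω₂ lam β γ).gibbsMeasure N T)) *
        Real.sqrt ((1 / 2) * ∑ i : Fin N, ∫ x, (U0 x - U0 (momentumFlip i x)) ^ 2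
          ∂((pinnedChain ω₂ lam β γ).gibbsMeasure N T)) := by
  set P := pinnedChain ω₂ lam β γ with hP
  set π := P.gibbsMeasure N T with hπ_def
  haveI : IsProbabilityMeasure π := pinnedChain_isProbabilityMeasure_gibbsMeasure hω hl hβ.le γ N hT
  have hU1 := pinnedChain_contDiff_U ω₂ lam β γ (n := 1)
  have hV1 := pinnedChain_contDiff_V ω₂ lam β γ (n := 1)
  have hΘi : ∀ i : Fin N, MeasurePreserving (momentumFlip i) π π := fun i =>
    P.measurePreserving_momentumFlip_gibbsMeasure N T i
  have hΘ : MeasurePreserving (momentumReversal N) π π :=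
    OddResponseBound.DensityUnique.measurePreserving_momentumReversal_gibbsMeasure P N T
  -- the McLennan data
  set c : ℝ := ((N : ℝ) - 1) * T ^ 2 with hc
  set Ψ : PhaseSpace N → ℝ := fun y => (((N : ℝ) - 1) * T ^ 2)⁻¹ * energyMoment P N y +
    (-(2 * T ^ 2)⁻¹) * P.hamiltonian N y with hΨ
  set φ : PhaseSpace N → ℝ := fun x => γ / (2 * T ^ 2) * (x.2 ⟨0, by omega⟩ ^ 2 - x.2 ⟨N - 1, by omega⟩ ^ 2)
    with hφ
  set J : PhaseSpace N → ℝ := fun x => ∑ i : Fin N, P.bondCurrent N i x with hJ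
  set W : PhaseSpace N → ℝ := fun x => Uε x - U0 x with hW
  have hc0 : 0 < c := by
    have h2 : (2 : ℝ) ≤ N := by exact_mod_cast hN
    have h1 : 0 < (N : ℝ) - 1 := by linarith
    positivity
  have hLΨ : ∀ x, P.generator N T T Ψ x = c⁻¹ * J x + φ x := fun x =>
    pinnedChain_generator_mclennanPotential hN T hT.ne' x
  -- `L²` memberships
  have hΨm : MemLp Ψ 2 π := memLp_mclennanPotential hω hl hβ hT N
  have hLΨm : MemLp (P.generator N T T Ψ) 2 π := memLp_generator_mclennanPotential hω hl hβ hT hN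
  have hφm : MemLp φ 2 π := memLp_mclennanSource hω hl hβ hT _ _
  have hJm : MemLp J 2 π := memLp_totalCurrent hω hl hβ hT N
  have hSUε : MemLp (flipNoise N Uε) 2 π := memLp_flipNoise hΘi hUεm
  have hWm : MemLp W 2 π := hUεm.sub hU0m
  have hw₂m : MemLp (fun x => -ε * flipNoise N Uε x) 2 π := hSUε.const_mul (-ε)
  have hU0Θm : MemLp (fun x : PhaseSpace N => U0 (x.1, -x.2)) 2 π := hU0m.comp_measurePreserving hΘ
  have hnegφm : MemLp (fun x => -φ x) 2 π := hφm.neg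
  have hUεΘi : ∀ i : Fin N, MemLp (fun x => Uε (momentumFlip i x)) 2 π := fun i =>
    hUεm.comp_measurePreserving (hΘi i)
  -- (2) the tested relation for `W`: `∫ (LF) W = ∫ F · (-ε S Uε)`
  have hEW : ∀ F : PhaseSpace N → ℝ, ContDiff ℝ ∞ F → HasCompactSupport F →
      ∫ x, P.generator N T T F x * W x ∂π = ∫ x, F x * (-ε * flipNoise N Uε x) ∂π := by
    intro F hF hFc
    have hFm : MemLp F 2 π := memLp_of_continuous_hasCompactSupport hF.continuous hFc π 2
    have hF2 : ContDiff ℝ 2 F := hF.of_le (by norm_cast)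
    have hLFm : MemLp (P.generator N T T F) 2 π :=
      memLp_of_continuous_hasCompactSupport (P.continuous_generator hU1 hV1 N T T hF2)
        (P.hasCompactSupport_generator N T T hF2 hFc) π 2
    have iLU0 : Integrable (fun x => P.generator N T T F x * U0 x) π := hLFm.integrable_mul hU0m
    have iLUε : Integrable (fun x => P.generator N T T F x * Uε x) π := hLFm.integrable_mul hUεm
    have iSF : Integrable (fun x => flipNoise N F x * Uε x) π :=
      (memLp_flipNoise hΘi hFm).integrable_mul hUεm
    have hsplit : ∫ x, P.flipGenerator N T T ε F x * Uε x ∂π =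
        (∫ x, P.generator N T T F x * Uε x ∂π) + ε * ∫ x, flipNoise N F x * Uε x ∂π := by
      rw [← integral_const_mul, ← integral_add iLUε (iSF.const_mul ε)]
      exact integral_congr_ae (Eventually.of_forall fun x => by
        simp only [OscillatorChain.flipGenerator_eq_add_flipNoise]
        ring)
    have hsym : ∫ x, flipNoise N F x * Uε x ∂π = ∫ x, F x * flipNoise N Uε x ∂π :=
      (integral_mul_flipNoise hΘi (hFm.integrable_mul hUεm) fun i => hFm.integrable_mul (hUεΘi i)).symm
    have h1 := hEε F hF hFc
    have h2 := hE0 F hF hFc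
    rw [hsplit, hsym] at h1
    have e : ∫ x, P.generator N T T F x * W x ∂π =
        (∫ x, P.generator N T T F x * Uε x ∂π) - ∫ x, P.generator N T T F x * U0 x ∂π := by
      rw [← integral_sub iLUε iLU0]
      exact integral_congr_ae (Eventually.of_forall fun x => by simp only [hW]; ring)
    have e2 : ∫ x, F x * (-ε * flipNoise N Uε x) ∂π = -ε * ∫ x, F x * flipNoise N Uε x ∂π := by
      rw [← integral_const_mul]
      exact integral_congr_ae (Eventually.of_forall fun x => by ring)
    rw [e, e2]
    linarith
  -- (3a) closure at the weak pair `(Ψ, LΨ)`: `c⁻¹ ∫ J W + ∫ φ W = ∫ Ψ (-ε S Uε) = 0`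
  have hA := integral_eq_of_weak_pair hω hl hβ.le hγ hN hT hΨm hLΨm
    (fun g hg hgc => weakPair_mclennanPotential ω₂ lam β γ N hT.ne' hg hgc) hWm hw₂m hEW
  have hA0 : ∫ x, Ψ x * (-ε * flipNoise N Uε x) ∂π = 0 := by
    have h := integral_mul_flipNoise hΘi (hΨm.integrable_mul hUεm) fun i => hΨm.integrable_mul (hUεΘi i)
    have hS0 : ∫ x, flipNoise N Ψ x * Uε x ∂π = 0 := by
      have e : (fun x => flipNoise N Ψ x * Uε x) = fun _ => 0 := by
        funext x
        rw [hΨ, flipNoise_mclennanPotential, zero_mul]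
      rw [e, integral_zero]
    calc ∫ x, Ψ x * (-ε * flipNoise N Uε x) ∂π = -ε * ∫ x, Ψ x * flipNoise N Uε x ∂π := by
          rw [← integral_const_mul]
          exact integral_congr_ae (Eventually.of_forall fun x => by ring)
      _ = 0 := by rw [h, hS0, mul_zero]
  have iJW : Integrable (fun x => J x * W x) π := hJm.integrable_mul hWm
  have iφW : Integrable (fun x => φ x * W x) π := hφm.integrable_mul hWm
  have hJW : ∫ x, J x * W x ∂π = -c * ∫ x, φ x * W x ∂π := by
    have e : ∫ x, P.generator N T T Ψ x * W x ∂π = c⁻¹ * (∫ x, J x * W x ∂π) + ∫ x, φ x * W x ∂π := by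
      rw [← integral_const_mul, ← integral_add (iJW.const_mul c⁻¹) iφW]
      exact integral_congr_ae (Eventually.of_forall fun x => by simp only [hLΨ]; ring)
    rw [e, hA0] at hA
    have hcc : c * c⁻¹ = 1 := mul_inv_cancel₀ hc0.ne'
    calc ∫ x, J x * W x ∂π = (c * c⁻¹) * ∫ x, J x * W x ∂π := by rw [hcc, one_mul]
      _ = c * (c⁻¹ * ∫ x, J x * W x ∂π) := by ring
      _ = c * (-∫ x, φ x * W x ∂π) := by rw [show c⁻¹ * ∫ x, J x * W x ∂π = -∫ x, φ x * W x ∂π by linarith]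
      _ = -c * ∫ x, φ x * W x ∂π := by ring
  -- (3b) closure at the weak pair `(U0∘Θ, -φ)`: `-∫ φ W = ∫ (U0∘Θ)(-ε S Uε)`
  have huv : ∀ g : PhaseSpace N → ℝ, ContDiff ℝ ∞ g → HasCompactSupport g →
      ∫ x, P.generator N T T g x * (fun y : PhaseSpace N => U0 (y.1, -y.2)) (x.1, -x.2) ∂π =
        ∫ x, g x * (fun y => -φ y) (x.1, -x.2) ∂π := by
    intro g hg hgc
    have h := hE0 g hg hgc
    have e1 : ∀ x : PhaseSpace N, (fun y : PhaseSpace N => U0 (y.1, -y.2)) (x.1, -x.2) = U0 x := fun x => by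
      simp
    have e2 : ∀ x : PhaseSpace N, (fun y => -φ y) (x.1, -x.2) = -φ x := fun x => by
      simp only [hφ, Pi.neg_apply, neg_sq]
    simp only [e1, e2, mul_neg, integral_neg]
    exact h
  have hB := integral_eq_of_weak_pair hω hl hβ.le hγ hN hT hU0Θm hnegφm huv hWm hw₂m hEW
  have hY : ∫ x, φ x * W x ∂π = ε * ∫ x, U0 (x.1, -x.2) * flipNoise N Uε x ∂π := by
    have e1 : ∫ x, (fun y => -φ y) x * W x ∂π = -∫ x, φ x * W x ∂π := by
      rw [← integral_neg]
      exact integral_congr_ae (Eventually.of_forall fun x => by ring)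
    have e2 : ∫ x, (fun y : PhaseSpace N => U0 (y.1, -y.2)) x * (-ε * flipNoise N Uε x) ∂π =
        -ε * ∫ x, U0 (x.1, -x.2) * flipNoise N Uε x ∂π := by
      rw [← integral_const_mul]
      exact integral_congr_ae (Eventually.of_forall fun x => by ring)
    rw [e1, e2] at hB
    linarith
  -- (4) Cauchy–Schwarz in the flip form
  have hCS := abs_integral_mul_flipNoise_le hΘi hU0Θm hUεm
  rw [flipEnergy_comp_reversal hΘ U0] at hCS
  have iJUε : Integrable (fun x => J x * Uε x) π := hJm.integrable_mul hUεm
  have iJU0 : Integrable (fun x => J x * U0 x) π := hJm.integrable_mul hU0m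
  have hdiff : (∫ x, J x * Uε x ∂π) - ∫ x, J x * U0 x ∂π = ∫ x, J x * W x ∂π := by
    rw [← integral_sub iJUε iJU0]
    exact integral_congr_ae (Eventually.of_forall fun x => by simp only [hW]; ring)
  rw [hdiff, hJW, hY]
  calc |-c * (ε * ∫ x, U0 (x.1, -x.2) * flipNoise N Uε x ∂π)|
      = c * ε * |∫ x, U0 (x.1, -x.2) * flipNoise N Uε x ∂π| := by
        rw [abs_mul, abs_mul, abs_neg, abs_of_pos hc0, abs_of_pos hε]
        ring
    _ ≤ c * ε * (Real.sqrt ((1 / 2) * ∑ i : Fin N, ∫ x, (Uε x - Uε (momentumFlip i x)) ^ 2 ∂π) *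
          Real.sqrt ((1 / 2) * ∑ i : Fin N, ∫ x, (U0 x - U0 (momentumFlip i x)) ^ 2 ∂π)) :=
        mul_le_mul_of_nonneg_left hCS (by positivity)
    _ = _ := by rw [hc]; ring

end StubDuhamelFlipBound

/-- **Registered stub 2 `stub_duhamelFlipBound` of crux `NoiseLocality` (line
`relative-flip-energy-transfer`).** For the pinned anharmonic chain (all parameters `> 0`), `T > 0`, any
`N`, any flip rate `ε > 0`, the unique deterministic weak steady family `μ0`, the unique weak steady family
`με` of `L + εS`, ANY response densities `U0`, `Uε` of the two families at `T` (square-integrable for the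
Gibbs measure, representing the `δ`-derivatives at `0` of `∫ g dμ_{T+δ/2,T-δ/2}` for test `g` and of the
total current) and the response coefficients `D0`, `Dε` (limits of `totalCurrent/δ` along `𝓝[≠] 0`):
`|Dε − D0| ≤ ε (N−1) T² √(½∑_i∫(Uε − Uε∘Θ_i)² dμ_T) √(½∑_i∫(U0 − U0∘Θ_i)² dμ_T)`.
See the module docstring for the proof (Duhamel identity in the flip Dirichlet form via the weak adjoint
equations, the graph closure of the equilibrium generator on test functions, the flip-invariant McLennan
potential, `L† = ΘLΘ`, and Cauchy–Schwarz). -/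
theorem stub_duhamelFlipBound :
    ∀ ω₂ lam β γ : ℝ, 0 < ω₂ → 0 < lam → 0 < β → 0 < γ → ∀ T : ℝ, 0 < T → ∀ (N : ℕ) (ε : ℝ), 0 < ε →
    ∀ μ0 με : ℝ → ℝ → MeasureTheory.Measure (Literature.MathematicalPhysics.KineticTheory.HeatConduction.PhaseSpace N),
    (∀ T_L T_R : ℝ, 0 < T_L → 0 < T_R →
      (Literature.MathematicalPhysics.KineticTheory.HeatConduction.pinnedChain ω₂ lam β γ).IsSteadyState N T_L T_R
          (μ0 T_L T_R) ∧
        ∀ ν : MeasureTheory.Measure (Literature.MathematicalPhysics.KineticTheory.HeatConduction.PhaseSpace N),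
          (Literature.MathematicalPhysics.KineticTheory.HeatConduction.pinnedChain ω₂ lam β γ).IsSteadyState N T_L T_R ν →
            ν = μ0 T_L T_R) →
    (∀ T_L T_R : ℝ, 0 < T_L → 0 < T_R →
      (Literature.MathematicalPhysics.KineticTheory.HeatConduction.pinnedChain ω₂ lam β γ).IsFlipSteadyState N T_L T_R ε
          (με T_L T_R) ∧
        ∀ ν : MeasureTheory.Measure (Literature.MathematicalPhysics.KineticTheory.HeatConduction.PhaseSpace N),
          (Literature.MathematicalPhysics.KineticTheory.HeatConduction.pinnedChain ω₂ lam β γ).IsFlipSteadyState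
              N T_L T_R ε ν → ν = με T_L T_R) →
    ∀ U0 Uε : Literature.MathematicalPhysics.KineticTheory.HeatConduction.PhaseSpace N → ℝ,
    (MeasureTheory.MemLp U0 2
          ((Literature.MathematicalPhysics.KineticTheory.HeatConduction.pinnedChain ω₂ lam β γ).gibbsMeasure N T) ∧
        (∀ g : Literature.MathematicalPhysics.KineticTheory.HeatConduction.PhaseSpace N → ℝ,
          ContDiff ℝ ((⊤ : ℕ∞) : WithTop ℕ∞) g → HasCompactSupport g →
            HasDerivAt (fun δ : ℝ => ∫ x, g x ∂(μ0 (T + δ / 2) (T - δ / 2)))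
              (∫ x, g x * U0 x
                ∂((Literature.MathematicalPhysics.KineticTheory.HeatConduction.pinnedChain ω₂ lam β γ).gibbsMeasure N T))
              0) ∧
        HasDerivAt (fun δ : ℝ =>
            (Literature.MathematicalPhysics.KineticTheory.HeatConduction.pinnedChain ω₂ lam β γ).totalCurrent
              (μ0 (T + δ / 2) (T - δ / 2)))
          (∑ i : Fin N, ∫ x,
            (Literature.MathematicalPhysics.KineticTheory.HeatConduction.pinnedChain ω₂ lam β γ).bondCurrent N i x * U0 x
              ∂((Literature.MathematicalPhysics.KineticTheory.HeatConduction.pinnedChain ω₂ lam β γ).gibbsMeasure N T))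
          0) →
    (MeasureTheory.MemLp Uε 2
          ((Literature.MathematicalPhysics.KineticTheory.HeatConduction.pinnedChain ω₂ lam β γ).gibbsMeasure N T) ∧
        (∀ g : Literature.MathematicalPhysics.KineticTheory.HeatConduction.PhaseSpace N → ℝ,
          ContDiff ℝ ((⊤ : ℕ∞) : WithTop ℕ∞) g → HasCompactSupport g →
            HasDerivAt (fun δ : ℝ => ∫ x, g x ∂(με (T + δ / 2) (T - δ / 2)))
              (∫ x, g x * Uε x
                ∂((Literature.MathematicalPhysics.KineticTheory.HeatConduction.pinnedChain ω₂ lam β γ).gibbsMeasure N T))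
              0) ∧
        HasDerivAt (fun δ : ℝ =>
            (Literature.MathematicalPhysics.KineticTheory.HeatConduction.pinnedChain ω₂ lam β γ).totalCurrent
              (με (T + δ / 2) (T - δ / 2)))
          (∑ i : Fin N, ∫ x,
            (Literature.MathematicalPhysics.KineticTheory.HeatConduction.pinnedChain ω₂ lam β γ).bondCurrent N i x * Uε x
              ∂((Literature.MathematicalPhysics.KineticTheory.HeatConduction.pinnedChain ω₂ lam β γ).gibbsMeasure N T))
          0) →
    ∀ D0 Dε : ℝ,
    Filter.Tendsto (fun δ : ℝ =>
        (Literature.MathematicalPhysics.KineticTheory.HeatConduction.pinnedChain ω₂ lam β γ).totalCurrent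
          (μ0 (T + δ / 2) (T - δ / 2)) / δ) (nhdsWithin 0 {(0 : ℝ)}ᶜ) (nhds D0) →
    Filter.Tendsto (fun δ : ℝ =>
        (Literature.MathematicalPhysics.KineticTheory.HeatConduction.pinnedChain ω₂ lam β γ).totalCurrent
          (με (T + δ / 2) (T - δ / 2)) / δ) (nhdsWithin 0 {(0 : ℝ)}ᶜ) (nhds Dε) →
    |Dε - D0| ≤ ε * ((N : ℝ) - 1) * T ^ 2 *
      Real.sqrt ((1 / 2) * ∑ i : Fin N, ∫ x,
        (Uε x - Uε (Literature.MathematicalPhysics.KineticTheory.HeatConduction.momentumFlip i x)) ^ 2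
          ∂((Literature.MathematicalPhysics.KineticTheory.HeatConduction.pinnedChain ω₂ lam β γ).gibbsMeasure N T)) *
      Real.sqrt ((1 / 2) * ∑ i : Fin N, ∫ x,
        (U0 x - U0 (Literature.MathematicalPhysics.KineticTheory.HeatConduction.momentumFlip i x)) ^ 2
          ∂((Literature.MathematicalPhysics.KineticTheory.HeatConduction.pinnedChain ω₂ lam β γ).gibbsMeasure N T)) := by
  intro ω₂ lam β γ hω hl hβ hγ T hT N ε hε μ0 με hμ0 hμε U0 Uε hU0 hUε D0 Dε hD0 hDε
  obtain ⟨hU0m, hU0g, hU0J⟩ := hU0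
  obtain ⟨hUεm, hUεg, hUεJ⟩ := hUε
  -- the diagonal members are the Gibbs measure
  have hπ0 : μ0 T T = (pinnedChain ω₂ lam β γ).gibbsMeasure N T :=
    StubResponseDensityDet.steadyFamily_eq_gibbsMeasure hω hl.le hβ.le γ hT μ0 hμ0
  have hπε : με T T = (pinnedChain ω₂ lam β γ).gibbsMeasure N T :=
    flipSteadyFamily_eq_gibbsMeasure hω hl.le hβ.le γ hT ε με hμε
  -- the response coefficients as pairings with the total current
  have hD0' := responseCoeff_eq μ0 hπ0 hU0J hD0
  have hDε' := responseCoeff_eq με hπε hUεJ hDε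
  rcases Nat.lt_or_ge N 2 with hN | hN
  · -- `N ≤ 1`: no current at all
    have hN1 : N ≤ 1 := by omega
    have h0 : D0 = 0 := responseCoeff_eq_zero_of_le_one (pinnedChain ω₂ lam β γ) hN1 μ0 hD0
    have hε0 : Dε = 0 := responseCoeff_eq_zero_of_le_one (pinnedChain ω₂ lam β γ) hN1 με hDε
    rw [h0, hε0, sub_zero, abs_zero]
    interval_cases N
    · simp
    · simp
  -- `N ≥ 2`
  haveI : IsProbabilityMeasure ((pinnedChain ω₂ lam β γ).gibbsMeasure N T) :=
    pinnedChain_isProbabilityMeasure_gibbsMeasure hω hl.le hβ.le γ N hT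
  -- the weak adjoint equations
  have hμ0' : ∀ T_L T_R : ℝ, 0 < T_L → 0 < T_R →
      (pinnedChain ω₂ lam β γ).IsFlipSteadyState N T_L T_R 0 (μ0 T_L T_R) := fun T_L T_R hL hR => by
    rw [OscillatorChain.isFlipSteadyState_zero_iff]
    exact (hμ0 T_L T_R hL hR).1
  have hE0 : ∀ F : PhaseSpace N → ℝ, ContDiff ℝ ∞ F → HasCompactSupport F →
      ∫ x, (pinnedChain ω₂ lam β γ).generator N T T F x * U0 x ∂((pinnedChain ω₂ lam β γ).gibbsMeasure N T) =
        -∫ x, F x * (γ / (2 * T ^ 2) * (x.2 ⟨0, by omega⟩ ^ 2 - x.2 ⟨N - 1, by omega⟩ ^ 2))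
          ∂((pinnedChain ω₂ lam β γ).gibbsMeasure N T) := by
    intro F hF hFc
    have h := integral_flipGenerator_mul_responseDensity_gibbs hω hl.le hβ.le hN hT 0 μ0 hμ0' hπ0 hU0g hF hFc
    simpa only [OscillatorChain.flipGenerator_zero] using h
  have hEε : ∀ F : PhaseSpace N → ℝ, ContDiff ℝ ∞ F → HasCompactSupport F →
      ∫ x, (pinnedChain ω₂ lam β γ).flipGenerator N T T ε F x * Uε x
          ∂((pinnedChain ω₂ lam β γ).gibbsMeasure N T) =
        -∫ x, F x * (γ / (2 * T ^ 2) * (x.2 ⟨0, by omega⟩ ^ 2 - x.2 ⟨N - 1, by omega⟩ ^ 2))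
          ∂((pinnedChain ω₂ lam β γ).gibbsMeasure N T) := fun F hF hFc =>
    integral_flipGenerator_mul_responseDensity_gibbs hω hl.le hβ.le hN hT ε με
      (fun T_L T_R hL hR => (hμε T_L T_R hL hR).1) hπε hUεg hF hFc
  -- `D = ∫ J U dμ_T`
  have hsum : ∀ U : PhaseSpace N → ℝ, MemLp U 2 ((pinnedChain ω₂ lam β γ).gibbsMeasure N T) →
      ∑ i : Fin N, ∫ x, (pinnedChain ω₂ lam β γ).bondCurrent N i x * U x ∂((pinnedChain ω₂ lam β γ).gibbsMeasure N T) =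
        ∫ x, (∑ i : Fin N, (pinnedChain ω₂ lam β γ).bondCurrent N i x) * U x
          ∂((pinnedChain ω₂ lam β γ).gibbsMeasure N T) := by
    intro U hU
    have hi : ∀ i : Fin N, Integrable (fun x => (pinnedChain ω₂ lam β γ).bondCurrent N i x * U x)
        ((pinnedChain ω₂ lam β γ).gibbsMeasure N T) := fun i =>
      (memLp_bondCurrent_gibbsMeasure hω hl.le hβ.le γ N hT i).integrable_mul hU
    rw [← integral_finsetSum _ fun i _ => hi i]
    exact integral_congr_ae (Eventually.of_forall fun x => by simp only [Finset.sum_mul])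
  rw [hD0', hDε', hsum U0 hU0m, hsum Uε hUεm]
  exact StubDuhamelFlipBound.abs_sub_le_of_weak hω hl.le hβ hγ hN hT hε hU0m hUεm hE0 hEε

end Summit.AtomisticToContinuum.FouriersLaw.Theorems.NoiseLocality

end
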